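import Literature.NumberTheory.LFunctions.Zhang2022.RepairCoverFrame
import Literature.NumberTheory.LFunctions.Zhang2022.RepairSection18Theta
import Literature.NumberTheory.LFunctions.Zhang2022.SkeletonPartThree

/-!
# Zhang (2022) §18-margin repair rung: TEAM R width-0 regression of the cover machinery

Trunk T-ANT (NumberTheory/LFunctions). Part of the REPAIR-or-BARRIER study (rung F-S1R) of the
failing inequality of record `Skeleton.Margin232` of Y. Zhang, *Discrete mean estimates and the
Landau–Siegel zero*, arXiv:2211.02515v1 [Zhang2022LandauSiegel] — **an unrefereed manuscript under
adjudication; nothing here asserts any of its claims**.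

**Purpose (the barrier-certificate lineage's regression duty).** Any Q2 barrier theorem
`∀ θ ∈ R, m₀ ≤ C₂₃₂(θ)` will be proved by running the generic cover machinery of
`RepairCoverFrame` (`coverCheck` → `psdLeafOK` → `posSemidef_of_coverCheck` →
`le_of_posSemidef_form`) over a box cover of the class `R`. Before that machinery is trusted on
wide cells, this file runs it at WIDTH ZERO — a degenerate cover whose single root box is the
printed-parameter fiber (no free real coordinates; `ι ∈ ℂ³` is eliminated exactly by the PSD
leaf, as it will be in every real cell) — and checks that the floors it yields REPRODUCE the
kernel exclusions of record:

* exclusion 1 (`Section18AllIota.C232G_ge`, printed `c₃₄`) and exclusion 2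
  (`C232cG_ge`, `0.5`-prefactor): re-derived end-to-end through the cover path, stated on the
  θ-generic functional `Repair.C232T` on the `ι`-family `thetaIota` (new statements
  `width0_C232T_ceiling`, `width0_C232T_ge_c`; the record statements themselves are NOT restated
  — the leaf data `QLitP`/`VQP`, `QLitC`/`VQC` and the banked kernel booleans `cert18all_p`,
  `cert18all_c` are REUSED, so the regression costs no new `decide`);
* exclusion 3 (`Skeleton.margin_fails_all_roundings`): transported onto the θ-generic `frakc3T`
  at `theta0` (`width0_margin_all_roundings`), with the `0.5`-prefactor corollary
  `not_margin232T_theta0_c` (the printed-prefactor corollary is `Repair.not_margin232T_theta0`);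
* exclusion 4 (`PartIIIMainOrderInfeasible.not_exists_admissible_deliverable`): already stated on
  the `ι`-family (`frakc2G`/`frakc2cG`, both `C233` readings) with no real coordinate to vary at
  width 0 — nothing to transport; it is cited here for the census and untouched.

What this file does NOT do: state or prove anything off the printed fiber (that is the cover
proper: repair seats p5/p6 and the two numeric lineages), restate any landed declaration, or make
any claim about Theorems 1–2 of the manuscript or about Landau–Siegel zeros.

## References

* Y. Zhang, arXiv:2211.02515v1 (2022), §2 (2.32), §18 p. 99. [cite: Zhang2022LandauSiegel, §18 p. 99]
* R. E. Moore, *Interval Analysis*, Prentice-Hall (1966), §4.4. [Moore1966]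
* S. M. Rump, *Verification of positive definiteness*, BIT 46 (2006) 433–452. [Rump2006]
-/

noncomputable section

open scoped ComplexOrder
open Literature.Analysis.ValidatedNumerics (Box KdCert)

namespace Literature.NumberTheory.LFunctions.Zhang2022

namespace Repair

/-! ### The width-0 cover: one degenerate root box (the printed-parameter fiber), one PSD leaf -/

/-- The printed-parameter fiber as a box: NO free real coordinates (every coordinate is pinned to
the junk interval `[0, 0]`); the only member is the zero point. This is the width-0 root over
which the `ι`-directions alone remain, eliminated by the PSD leaf. [folklore] -/
def fiberBox : Box := []

/-- The zero point lies in the fiber box (the `[0, 0]` junk-interval convention of `Box.mem`).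
[cite: Moore1966, §4.4] -/
theorem fiberBox_mem_zero : fiberBox.mem (fun _ => 0) := by
  intro i
  constructor <;> simp [Box.ivl, fiberBox]

/-- Width-0 cover, printed-`c₃₄` reading: the single leaf carries the RECORD's literal box table
`QLitP` and integer eigenbasis `VQP` of `Section18AllIota.cert18all_p`. [cite: Rump2006, §1] -/
def width0CoverP : List (Box × KdCert (Option (PsdLeaf 4))) :=
  [(fiberBox, KdCert.leaf (some ⟨QLitP, VQP⟩))]

/-- Width-0 cover, `0.5`-prefactor reading: leaf data `QLitC`/`VQC` of `cert18all_c`. [cite: Rump2006, §1] -/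
def width0CoverC : List (Box × KdCert (Option (PsdLeaf 4))) :=
  [(fiberBox, KdCert.leaf (some ⟨QLitC, VQC⟩))]

/-- **The machinery's checker accepts the width-0 cover (printed reading)** — reusing the banked
kernel booleans of `cert18all_p`, so no new `decide` is run. [cite: Rump2006, §1] -/
theorem width0CoverP_check :
    coverCheck (psdLeafOK (fun _ => false) (fun _ => true) (fun _ => QBox c34B (3095/100000)))
      width0CoverP = true := by
  simp [width0CoverP, coverCheck, KdCert.check, psdLeafOK, cert18all_p.1, cert18all_p.2]

/-- **The machinery's checker accepts the width-0 cover (`0.5`-prefactor reading)** — reusing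
`cert18all_c`. [cite: Rump2006, §1] -/
theorem width0CoverC_check :
    coverCheck (psdLeafOK (fun _ => false) (fun _ => true) (fun _ => QBox c34cB (2491/100000)))
      width0CoverC = true := by
  simp [width0CoverC, coverCheck, KdCert.check, psdLeafOK, cert18all_c.1, cert18all_c.2]

/-! ### The floors of record, re-derived through the cover path -/

/-- PSD of the printed-reading record matrix, derived THROUGH `posSemidef_of_coverCheck` on the
width-0 cover (machinery path; private — the public record statement is
`Section18AllIota.QM_p_posSemidef` and is not restated). [cite: Rump2006, §1] -/
private theorem width0_psd_p : (QM c34 (3095/100000)).PosSemidef := by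
  refine posSemidef_of_coverCheck (R := fun _ => True)
      (Q := fun _ => QM c34 (3095/100000)) (excl := fun _ => false) (ok := fun _ => true)
      (QB := fun _ => QBox c34B (3095/100000)) ?_ ?_ ?_ width0CoverP_check (fun _ => 0) ?_ trivial
  · intro B hB; simp at hB
  · intro B _ x _ _; exact mem_QBox mem_c34 _
  · intro x _; exact QM_conjTranspose _ _
  · exact ⟨(fiberBox, KdCert.leaf (some ⟨QLitP, VQP⟩)), by simp [width0CoverP], fiberBox_mem_zero⟩

/-- PSD of the `0.5`-prefactor record matrix through the cover path (private; the public record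
statement is `QM_c_posSemidef`). [cite: Rump2006, §1] -/
private theorem width0_psd_c : (QM c34c (2491/100000)).PosSemidef := by
  refine posSemidef_of_coverCheck (R := fun _ => True)
      (Q := fun _ => QM c34c (2491/100000)) (excl := fun _ => false) (ok := fun _ => true)
      (QB := fun _ => QBox c34cB (2491/100000)) ?_ ?_ ?_ width0CoverC_check (fun _ => 0) ?_ trivial
  · intro B hB; simp at hB
  · intro B _ x _ _; exact mem_QBox mem_c34c _
  · intro x _; exact QM_conjTranspose _ _
  · exact ⟨(fiberBox, KdCert.leaf (some ⟨QLitC, VQC⟩)), by simp [width0CoverC], fiberBox_mem_zero⟩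

/-- **Width-0 regression of exclusion 2** on the θ-generic functional: for every `ι ∈ ℂ³`,
`0.02491 ≤ C232T (thetaIota ι) 𝔠₁(ι₂) 𝔠₂ᶜ(ι₃,ι₄)` — the floor of `C232cG_ge`, re-derived through
the cover machinery and transported by `C232T_thetaIota_c`. (The printed-reading companion of
`Repair.C232T_thetaIota_ge`.) [cite: Zhang2022LandauSiegel, (2.32), §9, §18] -/
theorem width0_C232T_ge_c (w2 w3 w4 : ℂ) :
    (0.02491 : ℝ) ≤ C232T (thetaIota w2 w3 w4) (frakc1G w2) (frakc2cG w3 w4) := by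
  rw [C232T_thetaIota_c]
  have h := C232X_ge_of_posSemidef width0_psd_c w2 w3 w4
  have e : (((2491/100000 : ℚ)) : ℝ) = 0.02491 := by norm_num
  rw [e] at h
  exact h

/-- **Width-0 regression of exclusion 1, ceiling form**: for every `ι ∈ ℂ³` the θ-generic
assembly at the printed exponents stays ABOVE the chain ceiling `25/3000` of
`SkeletonAssembly.margin_budget` — `no_iota_meets_ceiling` re-derived end-to-end through the
cover machinery on the θ-generic functional. [cite: Zhang2022LandauSiegel, (2.32), §18] -/
theorem width0_C232T_ceiling (w2 w3 w4 : ℂ) :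
    ¬ (C232T (thetaIota w2 w3 w4) (frakc1G w2) (frakc2G w3 w4) < 25/3000) := by
  rw [C232T_thetaIota]
  have h := C232X_ge_of_posSemidef width0_psd_p w2 w3 w4
  intro hlt
  have : ((3095/100000 : ℚ) : ℝ) < 25/3000 := lt_of_le_of_lt h hlt
  norm_num at this

/-- the `0.5`-prefactor ceiling twin. [cite: Zhang2022LandauSiegel, (2.32), §9, §18] -/
theorem width0_C232T_ceiling_c (w2 w3 w4 : ℂ) :
    ¬ (C232T (thetaIota w2 w3 w4) (frakc1G w2) (frakc2cG w3 w4) < 25/3000) := by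
  intro hlt
  have h := width0_C232T_ge_c w2 w3 w4
  have : (0.02491 : ℝ) < 25/3000 := lt_of_le_of_lt h hlt
  norm_num at this

/-! ### Exclusion 3 transported to the θ-generic margin functional at `θ₀` -/

/-- **Width-0 regression of exclusion 3**: `Skeleton.margin_fails_all_roundings` transported onto
the θ-generic `frakc3T` at `theta0` — for every rounding `|ε| ≤ 10⁻⁵` and BOTH prefactor
readings, the assembly exceeds `0.05`. [cite: Zhang2022LandauSiegel, §18 p. 99] -/
theorem width0_margin_all_roundings (ε : ℝ) (hε : |ε| ≤ 1e-5) :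
    0.05 < frakc1.re + frakc2.re + 2 * ((frakc3T theta0).re + ε) ∧
      0.05 < frakc1.re + frakc2c.re + 2 * ((frakc3T theta0).re + ε) := by
  rw [frakc3T_theta0]
  exact Skeleton.margin_fails_all_roundings ε hε

/-- The `0.5`-prefactor corollary missing from the landed regressions: the θ-generic margin
predicate FAILS at `θ₀` also when fed the corrected `𝔠₂ᶜ` (the printed-`𝔠₂` form is
`Repair.not_margin232T_theta0`). [cite: Zhang2022LandauSiegel, §18 p. 99] -/
theorem not_margin232T_theta0_c : ¬ Margin232T theta0 frakc1 frakc2c := by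
  intro h
  have h5 := (width0_margin_all_roundings (1e-5) (le_of_eq (abs_of_nonneg (by norm_num)))).2
  unfold Margin232T margin232LHS at h
  linarith

end Repair

end Literature.NumberTheory.LFunctions.Zhang2022
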